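import Literature.MathematicalPhysics.QuantumFieldTheory.Balaban1983to89.B9Thm311SmallFieldClosed
import Literature.MathematicalPhysics.QuantumFieldTheory.Balaban1983to89.B9Eq3126GreenLetters

/-!
# `Balaban1983to89.B9Thm311SmallFieldGreen` — T. Bałaban, *Propagators for lattice gauge theories in a background field*, Commun. Math. Phys.
# **99** (1985) 389–434 [Balaban1985BackgroundPropagators] Thm 3.4 p. 397 / (3.86) p. 407 *«G(U′U) = G(U)(I − V(A)G(U))⁻¹ … convergence is in
# the operator norm for α₁ sufficiently small»* with Thm 3.11 p. 416: THE FULL `Δ_a(U)` OF THE pub-balaban NE9 CHAIN IS UNIFORMLY COERCIVE AND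
# `G₁(U) = Δ_a(U)⁻¹` IS UNIFORMLY BOUNDED AT EVERY SMALL FIELD OF A FIXED LATTICE (crude operator norm, no decay)

statement-level skeleton of published theorems with citation tags; proofs where landed; nothing here is a claim about the Yang–Mills mass gap

PDF held: `paper:balaban1985-cmp99-background-propagators` (journal page = PDF page + 388), pp. 397, 404, 407, 416 read by this seat (2026-08-22).

THE PRINT (verbatim).  p. 407, (3.86): *«G(U′U) = G(U)(I − V(A)G(U))⁻¹ = Σ_{n=0}^∞ G(U)(V(A)G(U))ⁿ, and convergence is in the operator norm for α₁
sufficiently small. … This way we get all these inequalities for the operator G(U′U) … Thus Theorem 3.4 is proved, assuming that Theorems 3.1–3.3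
hold.»*  p. 416: *«Theorem 3.11. … the operators Δ′_a, G′, (Q′G′²Q′*)⁻¹, Δ_a, G are positive definite.»*

WHY THIS FILE (cell context).  `B9Thm311SmallFieldClosed` (owner gen 80) proves Thm 3.11 for the chain's assembled `Δ_a(U)` at every small
field of a fixed lattice (positivity).  The NE9 letters downstream (`G₁(U) = B11Eq103H1Complex.G1LatticeK hpos`, `H₁(U)`, `𝔊(U)`, the chart radii
of `Support/NE9CurChartOfBackground` via `exists_twoRegimes_radii (B₀ := ‖𝔊(U)‖, b := ‖H(U)‖)`) need MORE than positivity to be controlled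
uniformly over the small-field set: a coercivity constant `γ₁` independent of `U` and the resulting bound `‖G₁(U)‖ ≤ γ₁⁻¹`.  This file supplies both.

WHAT IS PROVED (sorry-free; no `Prop` placeholder; no inequality of the paper asserted as a hypothesis-free fact).
* (the abstract `norm_greenK_le` — `γ`-coercive ⇒ `‖T⁻¹y‖ ≤ γ⁻¹‖y‖` — is `B9Eq3126GreenLetters` §0.)
* §1 **`exists_coercive_laplaceA_of_small_field`**: `∃ γ₁ ε₃ > 0` such that for every background `U` of E162's data with `‖U(b) − 1‖ ≤ ε ≤ ε₃` and
  `hRS`: `γ₁‖x‖² ≤ re⟨x, Δ_a(U)x⟩` at `B9Eq315QTorus.laplaceAofBackground` (principal coercivity of `B9Thm311SmallFieldClosed` + the curvature form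
  bound of `B9Ineq369CurvatureSmall` at plaquettes `4ε`-small); **`norm_G1_le_of_small_field`**: for every such `U` and any positivity witness,
  `‖G1LatticeK hpos y‖ ≤ γ₁⁻¹‖y‖`.
MODEL / DECLARED READINGS.  (M1)/(M2) as `B9Thm311SmallFieldClosed` (displayed: `hRS`, `M_φ`, `M_φ′`, `C_τ`, `a > 0`, `η ≠ 0`).  (M3) NOT HERE: decay
((3.42)–(3.47)), uniformity in the lattice, the bounds of `H₁(U)`, `𝔊(U)` (compositions with `Q`, `(QG₁Q*)⁻¹` — the latter needs its own lower bound).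
HONEST SCOPE.  Lax–Milgram-type bookkeeping on the chain's OWN letters at a fixed lattice; NOT summit progress (cell pub-balaban: NE9 NOT PRINTED / NOT
PROVED; spine PROVED 0/9).  Filed by the pub-balaban NE9 BINDER-row owner lineage `b2b-balaban-t4-ne9-p1` (gen 80); NEW file importing
`B9Thm311SmallFieldClosed`, `B9Eq3126GreenLetters`; nothing modified.  Net new unproved facts: 0.
-/

noncomputable section

open scoped InnerProductSpace ComplexConjugate BigOperators

namespace Literature.MathematicalPhysics.QuantumFieldTheory.Balaban1983to89.B9Thm311SmallFieldGreen

open B4Sect5Torus (TSite)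
open B9SectCLatticeCarrier (Bond)
open B7Prop1Explicit (U1 Wcx boxVec)
open B9Eq311L2Pairing (WL2)
open B9Eq319QprimeTorus (fineP)
open B11Eq103H1Complex (SiteL2K BondL2K laplaceALatticeK greenK apply_greenK G1LatticeK)
open B9Eq310HessianOperator (adTransportW principalOpK hessOp hessOp_apply curvOp)
open B9Eq310DeltaPrime (plaqHolU)
open B9Eq326OperatorAssembly (RofU QprimeW)
open B9Eq315QTorus (perCfg cornerSite QtorusW laplaceAofBackground)
open B9Eq315QTorusOnto (liftSite perSite_liftSite)
open B9Ineq369CurvatureSmall (norm_inner_curvOp_self_le)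
open B9Thm311SmallFieldClosed (norm_plaqHolU_sub_one_le exists_coercive_principal_of_small_field₀)
open B9Eq3126GreenLetters (norm_greenK_le)

/-! ## §1 The full `Δ_a(U)` is uniformly coercive at every small field; `G₁(U) = Δ_a(U)⁻¹` is uniformly bounded -/

section SmallField

variable {d : ℕ} (L : ℕ) [NeZero L] (m : Fin d → ℕ) [∀ i, NeZero (fineP L m i)] (hL : 1 ≤ L)
  {𝔸 : Type*} [NormedRing 𝔸] [NormedAlgebra ℂ 𝔸] [CompleteSpace 𝔸] [NormOneClass 𝔸] [StarRing 𝔸] [NormedStarGroup 𝔸] [StarModule ℂ 𝔸]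
  {W : Type*} [NormedAddCommGroup W] [InnerProductSpace ℂ W] [FiniteDimensional ℂ W] (φ : W ≃ₗ[ℂ] 𝔸) {c₀ c₁ : ℝ} [Fact (0 < c₀)] [Fact (0 < c₁)]

/-- **THE ASSEMBLED `Δ_a(U) = Δ(U) + DR(U)D* + aQ(U)*Q(U)` IS UNIFORMLY COERCIVE AT EVERY SMALL FIELD OF A FIXED LATTICE**: there are `γ₁, ε₃ > 0`
such that for every background `U` of E162's data with `‖U(b) − 1‖ ≤ ε ≤ ε₃` and `hRS`, `γ₁‖x‖² ≤ re⟨x, Δ_a(U)x⟩` — the principal coercivity `γ` of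
`B9Thm311SmallFieldClosed.exists_coercive_principal_of_small_field₀` minus the curvature form bound `128d·C_τ·M_φ²(|η|^d/c₀)|η|⁻²·ε ≤ γ/2`
(`B9Ineq369CurvatureSmall.norm_inner_curvOp_self_le`, plaquettes `4ε`-small); `γ₁ = γ/2`. [cite: Balaban1985BackgroundPropagators, Thm 3.11 p.416, (3.69) p.404, p.392] -/
theorem exists_coercive_laplaceA_of_small_field {η : ℝ} (hη : η ≠ 0) {a : ℝ} (ha : 0 < a) {Mφ Mφ' : ℝ} (hMφ : 0 ≤ Mφ) (hMφ' : 0 ≤ Mφ')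
    (hφ : ∀ w, ‖φ w‖ ≤ Mφ * ‖w‖) (hφ' : ∀ X, ‖φ.symm X‖ ≤ Mφ' * ‖X‖) (τ : 𝔸 →ₗ[ℂ] ℂ) {Cτ : ℝ} (hτ : ∀ X, ‖τ X‖ ≤ Cτ * ‖X‖) (hCτ : 0 ≤ Cτ) :
    ∃ γ₁ ε₃ : ℝ, 0 < γ₁ ∧ 0 < ε₃ ∧ ∀ (U : Bond d (fineP L m) → 𝔸ˣ) {α : ℝ} (hα1 : α ≤ 1 / 64)
      (hU1 : ∀ (x : B7Prop1Explicit.Site d) (κ : Fin d), perCfg (fineP L m) U x κ ∈ U1 𝔸)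
      (hreg : ∀ (y : TSite d m) (κ : Fin d) (r : Fin d → Fin L), ‖((Wcx L (perCfg (fineP L m) U) (cornerSite L y) κ (boxVec L r) : 𝔸ˣ) : 𝔸) - 1‖ ≤ α)
      {ε : ℝ}, 0 ≤ ε → ε ≤ ε₃ → (∀ b, ‖(U b : 𝔸) - 1‖ ≤ ε) →
      (∀ (b : Bond d (fineP L m)) (v u : W), ⟪adTransportW φ U b v, u⟫_ℂ = ⟪v, adTransportW φ (fun b => (U b)⁻¹) b u⟫_ℂ) →
      ∀ x : BondL2K ℂ d (fineP L m) c₀ W, γ₁ * ‖x‖ ^ 2 ≤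
        RCLike.re ⟪x, laplaceAofBackground L m hL φ U hα1 hU1 hreg τ η (c₀ := c₀) (c₁ := c₁) a x⟫_ℂ := by
  have hc₀ : 0 < c₀ := Fact.out
  obtain ⟨γ, ε₂, hγ, hε₂, H⟩ := exists_coercive_principal_of_small_field₀ L m hL φ (c₀ := c₀) (c₁ := c₁) hη ha hMφ hMφ' hφ hφ'
  obtain ⟨Kc, hKcdef⟩ : ∃ Kc : ℝ, Kc = 32 * d * Cτ * Mφ ^ 2 * (|η| ^ d / c₀) * (‖((η : ℂ))⁻¹‖ ^ 2 * 4) := ⟨_, rfl⟩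
  have hKc : 0 ≤ Kc := by rw [hKcdef]; positivity
  refine ⟨γ / 2, min ε₂ (γ / (Kc + 1) / 2), by positivity, by positivity, ?_⟩
  intro U α hα1 hU1 hreg ε hε hε₃ hUε hRS x
  have hUb : ∀ b : Bond d (fineP L m), ‖(U b : 𝔸)‖ ≤ 1 ∧ ‖(((U b)⁻¹ : 𝔸ˣ) : 𝔸)‖ ≤ 1 := fun b => by
    obtain ⟨y, κ⟩ := b
    have h := hU1 (liftSite y) κ
    rw [B9Eq315QTorus.perCfg_apply, perSite_liftSite] at h
    exact B7Prop1Explicit.mem_U1.1 h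
  have hpl : ∀ p : B9SectCLatticeCarrier.Plaq d (fineP L m), ‖(plaqHolU U p : 𝔸) - 1‖ ≤ 4 * ε :=
    norm_plaqHolU_sub_one_le (fun b => B7Prop1Explicit.mem_U1.2 (hUb b)) hUε
  have hγU := H U hα1 hU1 hreg hε (hε₃.trans (min_le_left _ _)) hUε hRS x
  have hK := norm_inner_curvOp_self_le φ hτ hCτ hφ η hUb hpl (by positivity) x
  -- `Kc·ε ≤ γ/2`
  have hKε : 32 * d * Cτ * Mφ ^ 2 * (|η| ^ d / c₀) * (‖((η : ℂ))⁻¹‖ ^ 2 * (4 * ε)) ≤ γ / 2 := by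
    have h1 : 32 * d * Cτ * Mφ ^ 2 * (|η| ^ d / c₀) * (‖((η : ℂ))⁻¹‖ ^ 2 * (4 * ε)) = Kc * ε := by rw [hKcdef]; ring
    rw [h1]
    have h2 : ε ≤ γ / (Kc + 1) / 2 := hε₃.trans (min_le_right _ _)
    have h3 : Kc * ε ≤ Kc * (γ / (Kc + 1) / 2) := mul_le_mul_of_nonneg_left h2 hKc
    have h4 : Kc * (γ / (Kc + 1) / 2) ≤ γ / 2 := by
      rw [mul_div_assoc', mul_div_assoc', div_div, div_le_div_iff₀ (by positivity) (by norm_num)]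
      nlinarith
    exact h3.trans h4
  -- split `Δ_a(U) = Δ_prin(U) + Δ′(U)`
  have hsplit : laplaceAofBackground L m hL φ U hα1 hU1 hreg τ η (c₀ := c₀) (c₁ := c₁) a x =
      laplaceALatticeK ((η : ℂ))⁻¹ (adTransportW φ U) (adTransportW φ fun b => (U b)⁻¹) (principalOpK φ η U) (RofU L m φ η U)
        (QtorusW L m hL φ U hα1 hU1 hreg (c₁ := c₁)) a x + curvOp φ τ η U x := by
    show laplaceALatticeK ((η : ℂ))⁻¹ (adTransportW φ U) (adTransportW φ fun b => (U b)⁻¹) (hessOp φ η U τ) (RofU L m φ η U)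
        (QtorusW L m hL φ U hα1 hU1 hreg (c₁ := c₁)) a x = _
    simp only [laplaceALatticeK, B11Eq103H1Complex.laplaceAK_apply, hessOp_apply]
    abel
  rw [hsplit, inner_add_right, map_add]
  have h2 : -(32 * d * Cτ * Mφ ^ 2 * (|η| ^ d / c₀) * (‖((η : ℂ))⁻¹‖ ^ 2 * (4 * ε)) * ‖x‖ ^ 2) ≤ RCLike.re ⟪x, curvOp φ τ η U x⟫_ℂ := by
    have h := (RCLike.abs_re_le_norm ⟪x, curvOp φ τ η U x⟫_ℂ).trans hK
    rw [abs_le] at h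
    exact h.1
  nlinarith [hγU, h2, hKε, sq_nonneg ‖x‖, mul_nonneg hKc hε]

/-- **`G₁(U) = Δ_a(U)⁻¹` IS UNIFORMLY BOUNDED AT EVERY SMALL FIELD OF A FIXED LATTICE**: with `γ₁, ε₃` of the previous theorem, for every such `U`
and ANY positivity witness `hpos` (e.g. `B9Thm311SmallFieldClosed.laplaceAofBackground_pos_of_small_field`), the chain's Green operator
`B11Eq103H1Complex.G1LatticeK hpos` at the assembled letters satisfies `‖G₁(U)y‖ ≤ γ₁⁻¹‖y‖` — print's Thm 3.4 «G(U) satisfies the bounds of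
Thm 3.1» in crude operator-norm form at a fixed lattice (no decay, no uniformity in the lattice). [cite: Balaban1985BackgroundPropagators, Thm 3.4 p.397, Thm 3.11 p.416, (3.86) p.407] -/
theorem norm_G1_le_of_small_field {η : ℝ} (hη : η ≠ 0) {a : ℝ} (ha : 0 < a) {Mφ Mφ' : ℝ} (hMφ : 0 ≤ Mφ) (hMφ' : 0 ≤ Mφ')
    (hφ : ∀ w, ‖φ w‖ ≤ Mφ * ‖w‖) (hφ' : ∀ X, ‖φ.symm X‖ ≤ Mφ' * ‖X‖) (τ : 𝔸 →ₗ[ℂ] ℂ) {Cτ : ℝ} (hτ : ∀ X, ‖τ X‖ ≤ Cτ * ‖X‖) (hCτ : 0 ≤ Cτ) :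
    ∃ γ₁ ε₃ : ℝ, 0 < γ₁ ∧ 0 < ε₃ ∧ ∀ (U : Bond d (fineP L m) → 𝔸ˣ) {α : ℝ} (hα1 : α ≤ 1 / 64)
      (hU1 : ∀ (x : B7Prop1Explicit.Site d) (κ : Fin d), perCfg (fineP L m) U x κ ∈ U1 𝔸)
      (hreg : ∀ (y : TSite d m) (κ : Fin d) (r : Fin d → Fin L), ‖((Wcx L (perCfg (fineP L m) U) (cornerSite L y) κ (boxVec L r) : 𝔸ˣ) : 𝔸) - 1‖ ≤ α)
      {ε : ℝ}, 0 ≤ ε → ε ≤ ε₃ → (∀ b, ‖(U b : 𝔸) - 1‖ ≤ ε) →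
      (∀ (b : Bond d (fineP L m)) (v u : W), ⟪adTransportW φ U b v, u⟫_ℂ = ⟪v, adTransportW φ (fun b => (U b)⁻¹) b u⟫_ℂ) →
      ∀ (hpos : ∀ x : BondL2K ℂ d (fineP L m) c₀ W, x ≠ 0 →
          0 < RCLike.re ⟪x, laplaceAofBackground L m hL φ U hα1 hU1 hreg τ η (c₀ := c₀) (c₁ := c₁) a x⟫_ℂ)
        (y : BondL2K ℂ d (fineP L m) c₀ W), ‖G1LatticeK hpos y‖ ≤ γ₁⁻¹ * ‖y‖ := by
  obtain ⟨γ₁, ε₃, hγ₁, hε₃, H⟩ := exists_coercive_laplaceA_of_small_field L m hL φ (c₀ := c₀) (c₁ := c₁) hη ha hMφ hMφ' hφ hφ' τ hτ hCτ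
  refine ⟨γ₁, ε₃, hγ₁, hε₃, fun U α hα1 hU1 hreg ε hε hεε₃ hUε hRS hpos y => ?_⟩
  exact norm_greenK_le hγ₁ (H U hα1 hU1 hreg hε hεε₃ hUε hRS) hpos y

end SmallField

end Literature.MathematicalPhysics.QuantumFieldTheory.Balaban1983to89.B9Thm311SmallFieldGreen

end
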